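import Summits.AtomisticToContinuum.Crystallization.Theorems.ReggeStarCoercivityDefectFreeCrystallizesRouteBetaFloor
import Summits.AtomisticToContinuum.Crystallization.Theorems.ReggeStarCoercivityDefectFreeCrystallizesRouteBetaCertificates

/-!
# Route β of line `palm-good-law`, PRICED-FLOOR form (crux `ReggeStarCoercivity.DefectFreeCrystallizes`,
# item stmt-AtomisticToContinuum-13603; lead c7, skeleton v21)

Lead c6 reduced the line's energy step to the `e*`-free funnel shell floor R2a″ (`RouteBetaFloor`, hypothesis `hR2a''`
there: a point-stationary rooted hard-core law a.s. carried by everywhere-`SetGood` Barlow-charted configurations in force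
balance, with zero mean virial stress and `E_P[h] ≤ hcpE a₀ h₀`, has a.s. a `1 %`-good root shell).  Lead c7's MIXTURE LEMMA
(the hypothesis class of R2a″ is convex — mixtures of point-stationary laws are point-stationary and every hypothesis is affine in
`P` — and contains a law with bad root shells, e.g. a pressure-balanced mixture of Palm laws of isotropically strained fcc
lattices) shows that R2a″ is EQUIVALENT to a floor on the whole class; so the honest core of the line is registered (skeleton v21,
`stub_funnelPricedFloor`) as the

**PRICED FUNNEL FLOOR** (hypothesis `hfloor` below): for the relaxed reference `(a₀, h₀)` and every hard core `δ > 0` there is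
`κ > 0` with `hcpE a₀ h₀ + κ·P(root shell not (1/100)-close-packed at a scale in [9/10, 1]) ≤ E_P[h]` for EVERY point-stationary
rooted `δ`-hard-core law a.s. carried by everywhere-`SetGood` Barlow-charted force-balanced configurations with zero mean virial
stress — no energy hypothesis.  It has the shape of the sibling cores of crux 14993 (`StackingHinge`, `stub_slpLawCoerciveLS`,
SLP-good class) and of crux 9226 (`LayeredLawsSelectHcp`, `1 %` tube): three cruxes, one floor theorem, three goodness classes.

This file (all `[folklore]` bookkeeping over landed theorems, no definitions):
* `funnelShellFloor_of_pricedFloor` — priced floor ⇒ R2a″ (`hcpE + κ·P(bad) ≤ E_P[h] ≤ hcpE` forces `P(bad) = 0`);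
* `defectFreeCrystallizes_of_pricedFloor` — priced floor → crux 9226 → the crux BY NAME (through the landed
  `RouteBetaFloor.defectFreeCrystallizes_of_funnelShellFloor`): the crux is CLOSED MODULO {priced funnel floor, 9226} in the tree;
* `pricedFloor_of_certificates` — the certificate entry point: bounded finite-range pointwise `ε`-certificates on force-balanced
  charted funnel configurations (the family of `RouteBetaCertificates.funnelShellFloor_of_certificates`) prove the priced floor itself,
  by the landed a.s. Mecke pricing `AeMeckePricing.stub_aeMeckePricing` and `ε → 0`.
-/

noncomputable section

open scoped ENNReal
open Filter Topology MeasureTheory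

namespace Summit.AtomisticToContinuum.Crystallization.Theorems.PalmGoodLaw.RouteBetaPricedFloor

open Summit.AtomisticToContinuum.Crystallization.Theses
open Summit.AtomisticToContinuum.Crystallization.Theorems.PalmUnimodularRigidity
open Literature.MathematicalPhysics.StatisticalMechanics Literature.Geometry.DiscreteGeometry
open Literature.Probability.Process

/-- **Priced funnel floor ⇒ the funnel shell floor R2a″** (anchor of this file).  If for the relaxed reference `(a₀,h₀)` and
every hard core `δ` some `κ > 0` prices bad root shells, `hcpE a₀ h₀ + κ·P(bad) ≤ E_P[h]`, on every point-stationary rooted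
`δ`-hard-core law a.s. carried by everywhere-`SetGood` Barlow-charted force-balanced configurations with zero mean virial stress,
then such a law with `E_P[h] ≤ hcpE a₀ h₀` has a.s. a `(1/100)`-close-packed root shell at a scale `a ∈ [9/10, 1]`:
`κ·P(bad) ≤ 0` gives `P(bad) = 0` (outer measure, `ae_iff`). [folklore] -/
theorem funnelShellFloor_of_pricedFloor :
    (∀ a₀ h₀ : ℝ, 189 / 200 ≤ a₀ → a₀ ≤ 199 / 200 → 77 / 100 ≤ h₀ → h₀ ≤ 163 / 200 →
          (∀ a h : ℝ, 0 < a → 0 < h →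
            Summit.AtomisticToContinuum.Crystallization.Theorems.PalmUnimodularRigidity.LayeredLawsSelectHcp.hcpE a₀ h₀ ≤
              Summit.AtomisticToContinuum.Crystallization.Theorems.PalmUnimodularRigidity.LayeredLawsSelectHcp.hcpE a h) →
          ∀ δ : ℝ, 0 < δ → ∃ κ : ℝ, 0 < κ ∧ ∀ P : Measure (Measure (EuclideanSpace ℝ (Fin 3))), IsProbabilityMeasure P →
            (∀ᵐ μ ∂P, IsRootedHardCore δ μ) → IsPointStationaryLaw P →
            (∀ᵐ μ ∂P, ∃ S : Set (EuclideanSpace ℝ (Fin 3)),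
              μ = (Measure.count : Measure (EuclideanSpace ℝ (Fin 3))).restrict S ∧
              (∀ y ∈ S, SetGood S y) ∧
              ∃ s : ℤ → ℤ, IsHaggSeq s ∧
                ∃ Φ : EuclideanSpace ℝ (Fin 3) → EuclideanSpace ℝ (Fin 3),
                  Set.BijOn Φ (barlowStacking 1 (Real.sqrt (2 / 3)) s) S ∧
                  ∀ p ∈ barlowStacking 1 (Real.sqrt (2 / 3)) s, ∀ q ∈ barlowStacking 1 (Real.sqrt (2 / 3)) s,
                    (dist p q = 1 ↔ (0 < dist (Φ p) (Φ q) ∧ dist (Φ p) (Φ q) < 6 / 5))) →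
            (∀ᵐ μ ∂P, ∃ S : Set (EuclideanSpace ℝ (Fin 3)),
              μ = (Measure.count : Measure (EuclideanSpace ℝ (Fin 3))).restrict S ∧
              ∀ p ∈ S, HasSum (fun q : {q : EuclideanSpace ℝ (Fin 3) // q ∈ S ∧ q ≠ p} =>
                (deriv lennardJones (dist p q.1) / dist p q.1) • (p - q.1)) 0) →
            (∀ M : EuclideanSpace ℝ (Fin 3) →L[ℝ] EuclideanSpace ℝ (Fin 3),
              ∫ μ, (∫ y, deriv lennardJones ‖y‖ / ‖y‖ * inner ℝ y (M y) ∂μ) ∂P = 0) →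
            Summit.AtomisticToContinuum.Crystallization.Theorems.PalmUnimodularRigidity.LayeredLawsSelectHcp.hcpE a₀ h₀ +
                κ * (P {μ | ¬ ∃ a : ℝ, 9 / 10 ≤ a ∧ a ≤ 1 ∧ ∃ T : Finset (EuclideanSpace ℝ (Fin 3)),
                  (↑T : Set (EuclideanSpace ℝ (Fin 3))) =
                    {y : EuclideanSpace ℝ (Fin 3) | μ {y} ≠ 0 ∧ y ≠ 0 ∧ ‖y‖ ≤ 5 / 4 * a} ∧
                  (ShellCloseTo (a / 100) T (Finset.image (fun v : EuclideanSpace ℝ (Fin 3) => a • v) fccKissingPattern) ∨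
                    ShellCloseTo (a / 100) T
                      (Finset.image (fun v : EuclideanSpace ℝ (Fin 3) => a • v) hcpKissingPattern))}).toReal ≤
              ∫ μ, (∫ y, lennardJones ‖y‖ ∂μ) / 2 ∂P) →
        ∀ a₀ h₀ : ℝ, 189 / 200 ≤ a₀ → a₀ ≤ 199 / 200 → 77 / 100 ≤ h₀ → h₀ ≤ 163 / 200 →
          (∀ a h : ℝ, 0 < a → 0 < h →
            Summit.AtomisticToContinuum.Crystallization.Theorems.PalmUnimodularRigidity.LayeredLawsSelectHcp.hcpE a₀ h₀ ≤
              Summit.AtomisticToContinuum.Crystallization.Theorems.PalmUnimodularRigidity.LayeredLawsSelectHcp.hcpE a h) →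
          ∀ δ : ℝ, 0 < δ → ∀ P : Measure (Measure (EuclideanSpace ℝ (Fin 3))), IsProbabilityMeasure P →
            (∀ᵐ μ ∂P, IsRootedHardCore δ μ) → IsPointStationaryLaw P →
            (∀ᵐ μ ∂P, ∃ S : Set (EuclideanSpace ℝ (Fin 3)),
              μ = (Measure.count : Measure (EuclideanSpace ℝ (Fin 3))).restrict S ∧
              (∀ y ∈ S, SetGood S y) ∧
              ∃ s : ℤ → ℤ, IsHaggSeq s ∧
                ∃ Φ : EuclideanSpace ℝ (Fin 3) → EuclideanSpace ℝ (Fin 3),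
                  Set.BijOn Φ (barlowStacking 1 (Real.sqrt (2 / 3)) s) S ∧
                  ∀ p ∈ barlowStacking 1 (Real.sqrt (2 / 3)) s, ∀ q ∈ barlowStacking 1 (Real.sqrt (2 / 3)) s,
                    (dist p q = 1 ↔ (0 < dist (Φ p) (Φ q) ∧ dist (Φ p) (Φ q) < 6 / 5))) →
            (∀ᵐ μ ∂P, ∃ S : Set (EuclideanSpace ℝ (Fin 3)),
              μ = (Measure.count : Measure (EuclideanSpace ℝ (Fin 3))).restrict S ∧
              ∀ p ∈ S, HasSum (fun q : {q : EuclideanSpace ℝ (Fin 3) // q ∈ S ∧ q ≠ p} =>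
                (deriv lennardJones (dist p q.1) / dist p q.1) • (p - q.1)) 0) →
            (∀ M : EuclideanSpace ℝ (Fin 3) →L[ℝ] EuclideanSpace ℝ (Fin 3),
              ∫ μ, (∫ y, deriv lennardJones ‖y‖ / ‖y‖ * inner ℝ y (M y) ∂μ) ∂P = 0) →
            (∫ μ, (∫ y, lennardJones ‖y‖ ∂μ) / 2 ∂P) ≤
              Summit.AtomisticToContinuum.Crystallization.Theorems.PalmUnimodularRigidity.LayeredLawsSelectHcp.hcpE a₀ h₀ →
            ∀ᵐ μ ∂P, ∃ a : ℝ, 9 / 10 ≤ a ∧ a ≤ 1 ∧ ∃ T : Finset (EuclideanSpace ℝ (Fin 3)),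
              (↑T : Set (EuclideanSpace ℝ (Fin 3))) =
                {y : EuclideanSpace ℝ (Fin 3) | μ {y} ≠ 0 ∧ y ≠ 0 ∧ ‖y‖ ≤ 5 / 4 * a} ∧
              (ShellCloseTo (a / 100) T (Finset.image (fun v : EuclideanSpace ℝ (Fin 3) => a • v) fccKissingPattern) ∨
                ShellCloseTo (a / 100) T (Finset.image (fun v : EuclideanSpace ℝ (Fin 3) => a • v) hcpKissingPattern))  := by
  intro hfloor a₀ h₀ ha₁ ha₂ hh₁ hh₂ hmin δ hδ P hP hcore hstat hchart hFB hZS hlevel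
  obtain ⟨κ, hκ, hfloorδ⟩ := hfloor a₀ h₀ ha₁ ha₂ hh₁ hh₂ hmin δ hδ
  have h := hfloorδ P hP hcore hstat hchart hFB hZS
  -- name the conclusion predicate
  set G : Measure (EuclideanSpace ℝ (Fin 3)) → Prop := fun μ => ∃ a : ℝ, 9 / 10 ≤ a ∧ a ≤ 1 ∧
      ∃ T : Finset (EuclideanSpace ℝ (Fin 3)),
        (↑T : Set (EuclideanSpace ℝ (Fin 3))) =
          {y : EuclideanSpace ℝ (Fin 3) | μ {y} ≠ 0 ∧ y ≠ 0 ∧ ‖y‖ ≤ 5 / 4 * a} ∧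
        (ShellCloseTo (a / 100) T (Finset.image (fun v : EuclideanSpace ℝ (Fin 3) => a • v) fccKissingPattern) ∨
          ShellCloseTo (a / 100) T (Finset.image (fun v : EuclideanSpace ℝ (Fin 3) => a • v) hcpKissingPattern))
    with hG
  have hx : (P {μ | ¬ G μ}).toReal ≤ 0 := by
    have h1 : κ * (P {μ | ¬ G μ}).toReal ≤ κ * 0 := by rw [mul_zero]; linarith
    exact le_of_mul_le_mul_left h1 hκ
  have h0 : (P {μ | ¬ G μ}).toReal = 0 := le_antisymm hx ENNReal.toReal_nonneg
  have hnull : P {μ | ¬ G μ} = 0 := by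
    rcases (ENNReal.toReal_eq_zero_iff _).1 h0 with h' | h'
    · exact h'
    · exact absurd h' (measure_ne_top P _)
  exact ae_iff.2 hnull

/-- **The crux from the priced funnel floor and crux 9226 (sorry-free)**: line `palm-good-law` closes
`ReggeStarCoercivity.DefectFreeCrystallizes` MODULO {the priced funnel floor, crux 9226 `LayeredLawsSelectHcp`} —
`funnelShellFloor_of_pricedFloor` followed by the landed `RouteBetaFloor.defectFreeCrystallizes_of_funnelShellFloor`
(relaxed reference, `e* ≤ hcpE`, a.s. force balance and zero mean stress of minimising laws, Aldous–Lyons, P1 good law,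
R1 funnel chart, crux 9227, R3 charging, item 2916 — all landed). [folklore] -/
theorem defectFreeCrystallizes_of_pricedFloor
    (hfloor : ∀ a₀ h₀ : ℝ, 189 / 200 ≤ a₀ → a₀ ≤ 199 / 200 → 77 / 100 ≤ h₀ → h₀ ≤ 163 / 200 →
            (∀ a h : ℝ, 0 < a → 0 < h →
              Summit.AtomisticToContinuum.Crystallization.Theorems.PalmUnimodularRigidity.LayeredLawsSelectHcp.hcpE a₀ h₀ ≤
                Summit.AtomisticToContinuum.Crystallization.Theorems.PalmUnimodularRigidity.LayeredLawsSelectHcp.hcpE a h) →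
            ∀ δ : ℝ, 0 < δ → ∃ κ : ℝ, 0 < κ ∧ ∀ P : Measure (Measure (EuclideanSpace ℝ (Fin 3))), IsProbabilityMeasure P →
              (∀ᵐ μ ∂P, IsRootedHardCore δ μ) → IsPointStationaryLaw P →
              (∀ᵐ μ ∂P, ∃ S : Set (EuclideanSpace ℝ (Fin 3)),
                μ = (Measure.count : Measure (EuclideanSpace ℝ (Fin 3))).restrict S ∧
                (∀ y ∈ S, SetGood S y) ∧
                ∃ s : ℤ → ℤ, IsHaggSeq s ∧
                  ∃ Φ : EuclideanSpace ℝ (Fin 3) → EuclideanSpace ℝ (Fin 3),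
                    Set.BijOn Φ (barlowStacking 1 (Real.sqrt (2 / 3)) s) S ∧
                    ∀ p ∈ barlowStacking 1 (Real.sqrt (2 / 3)) s, ∀ q ∈ barlowStacking 1 (Real.sqrt (2 / 3)) s,
                      (dist p q = 1 ↔ (0 < dist (Φ p) (Φ q) ∧ dist (Φ p) (Φ q) < 6 / 5))) →
              (∀ᵐ μ ∂P, ∃ S : Set (EuclideanSpace ℝ (Fin 3)),
                μ = (Measure.count : Measure (EuclideanSpace ℝ (Fin 3))).restrict S ∧
                ∀ p ∈ S, HasSum (fun q : {q : EuclideanSpace ℝ (Fin 3) // q ∈ S ∧ q ≠ p} =>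
                  (deriv lennardJones (dist p q.1) / dist p q.1) • (p - q.1)) 0) →
              (∀ M : EuclideanSpace ℝ (Fin 3) →L[ℝ] EuclideanSpace ℝ (Fin 3),
                ∫ μ, (∫ y, deriv lennardJones ‖y‖ / ‖y‖ * inner ℝ y (M y) ∂μ) ∂P = 0) →
              Summit.AtomisticToContinuum.Crystallization.Theorems.PalmUnimodularRigidity.LayeredLawsSelectHcp.hcpE a₀ h₀ +
                  κ * (P {μ | ¬ ∃ a : ℝ, 9 / 10 ≤ a ∧ a ≤ 1 ∧ ∃ T : Finset (EuclideanSpace ℝ (Fin 3)),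
                    (↑T : Set (EuclideanSpace ℝ (Fin 3))) =
                      {y : EuclideanSpace ℝ (Fin 3) | μ {y} ≠ 0 ∧ y ≠ 0 ∧ ‖y‖ ≤ 5 / 4 * a} ∧
                    (ShellCloseTo (a / 100) T (Finset.image (fun v : EuclideanSpace ℝ (Fin 3) => a • v) fccKissingPattern) ∨
                      ShellCloseTo (a / 100) T
                        (Finset.image (fun v : EuclideanSpace ℝ (Fin 3) => a • v) hcpKissingPattern))}).toReal ≤
                ∫ μ, (∫ y, lennardJones ‖y‖ ∂μ) / 2 ∂P )
    (h9226 : PalmUnimodularRigidity.LayeredLawsSelectHcp) :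
    Summit.AtomisticToContinuum.Crystallization.Theses.ReggeStarCoercivity.DefectFreeCrystallizes :=
  RouteBetaFloor.defectFreeCrystallizes_of_funnelShellFloor (funnelShellFloor_of_pricedFloor hfloor) h9226

/-- **The priced funnel floor FROM FUNNEL CERTIFICATES (the certificate prover's entry point).**  If for the relaxed reference
there is a price `κ > 0` such that for every hard core `δ > 0` and every `ε > 0` some bounded finite-range jointly measurable bond
transfer `t` certifies, on EVERY rooted `δ`-hard-core configuration that is everywhere-`SetGood`, Barlow-charted and in force balance
at every point, the pointwise inequality `hcpE a₀ h₀ − ε ≤ h(μ) + div t(μ)`, improved by `κ` when the root shell is not `1 %`-good,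
then the priced floor holds with that `κ`: the landed a.s. Mecke pricing (`AeMeckePricing.stub_aeMeckePricing`) gives
`hcpE a₀ h₀ − ε + κ·P*(bad) ≤ E_P[h]` for every `ε > 0`. [folklore] -/
theorem pricedFloor_of_certificates
    (hcert : ∀ a₀ h₀ : ℝ, 189 / 200 ≤ a₀ → a₀ ≤ 199 / 200 → 77 / 100 ≤ h₀ → h₀ ≤ 163 / 200 →
            (∀ a h : ℝ, 0 < a → 0 < h →
              Summit.AtomisticToContinuum.Crystallization.Theorems.PalmUnimodularRigidity.LayeredLawsSelectHcp.hcpE a₀ h₀ ≤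
                Summit.AtomisticToContinuum.Crystallization.Theorems.PalmUnimodularRigidity.LayeredLawsSelectHcp.hcpE a h) →
            ∃ κ : ℝ, 0 < κ ∧ ∀ δ : ℝ, 0 < δ → ∀ ε : ℝ, 0 < ε →
              ∃ R M : ℝ, ∃ t : Measure (EuclideanSpace ℝ (Fin 3)) → EuclideanSpace ℝ (Fin 3) → ℝ,
                (Measurable (Function.uncurry t) ∧ (∀ μ y, |t μ y| ≤ M) ∧ ∀ μ y, R < ‖y‖ → t μ y = 0) ∧
                ∀ μ : Measure (EuclideanSpace ℝ (Fin 3)), IsRootedHardCore δ μ →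
                  (∃ S : Set (EuclideanSpace ℝ (Fin 3)),
                    μ = (Measure.count : Measure (EuclideanSpace ℝ (Fin 3))).restrict S ∧
                    (∀ y ∈ S, SetGood S y) ∧
                    ∃ s : ℤ → ℤ, IsHaggSeq s ∧
                      ∃ Φ : EuclideanSpace ℝ (Fin 3) → EuclideanSpace ℝ (Fin 3),
                        Set.BijOn Φ (barlowStacking 1 (Real.sqrt (2 / 3)) s) S ∧
                        ∀ p ∈ barlowStacking 1 (Real.sqrt (2 / 3)) s, ∀ q ∈ barlowStacking 1 (Real.sqrt (2 / 3)) s,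
                          (dist p q = 1 ↔ (0 < dist (Φ p) (Φ q) ∧ dist (Φ p) (Φ q) < 6 / 5))) →
                  (∃ S : Set (EuclideanSpace ℝ (Fin 3)),
                    μ = (Measure.count : Measure (EuclideanSpace ℝ (Fin 3))).restrict S ∧
                    ∀ p ∈ S, HasSum (fun q : {q : EuclideanSpace ℝ (Fin 3) // q ∈ S ∧ q ≠ p} =>
                      (deriv lennardJones (dist p q.1) / dist p q.1) • (p - q.1)) 0) →
                  (Summit.AtomisticToContinuum.Crystallization.Theorems.PalmUnimodularRigidity.LayeredLawsSelectHcp.hcpE a₀ h₀ - ε ≤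
                      (∫ y, lennardJones ‖y‖ ∂μ) / 2 + ∫ y, (t μ y - t (Measure.map (fun z => z - y) μ) (-y)) ∂μ) ∧
                  ((¬ ∃ a : ℝ, 9 / 10 ≤ a ∧ a ≤ 1 ∧ ∃ T : Finset (EuclideanSpace ℝ (Fin 3)),
                      (↑T : Set (EuclideanSpace ℝ (Fin 3))) =
                        {y : EuclideanSpace ℝ (Fin 3) | μ {y} ≠ 0 ∧ y ≠ 0 ∧ ‖y‖ ≤ 5 / 4 * a} ∧
                      (ShellCloseTo (a / 100) T (Finset.image (fun v : EuclideanSpace ℝ (Fin 3) => a • v) fccKissingPattern) ∨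
                        ShellCloseTo (a / 100) T (Finset.image (fun v : EuclideanSpace ℝ (Fin 3) => a • v) hcpKissingPattern))) →
                    Summit.AtomisticToContinuum.Crystallization.Theorems.PalmUnimodularRigidity.LayeredLawsSelectHcp.hcpE a₀ h₀ - ε + κ ≤
                      (∫ y, lennardJones ‖y‖ ∂μ) / 2 + ∫ y, (t μ y - t (Measure.map (fun z => z - y) μ) (-y)) ∂μ)) :    ∀ a₀ h₀ : ℝ, 189 / 200 ≤ a₀ → a₀ ≤ 199 / 200 → 77 / 100 ≤ h₀ → h₀ ≤ 163 / 200 →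
          (∀ a h : ℝ, 0 < a → 0 < h →
            Summit.AtomisticToContinuum.Crystallization.Theorems.PalmUnimodularRigidity.LayeredLawsSelectHcp.hcpE a₀ h₀ ≤
              Summit.AtomisticToContinuum.Crystallization.Theorems.PalmUnimodularRigidity.LayeredLawsSelectHcp.hcpE a h) →
          ∀ δ : ℝ, 0 < δ → ∃ κ : ℝ, 0 < κ ∧ ∀ P : Measure (Measure (EuclideanSpace ℝ (Fin 3))), IsProbabilityMeasure P →
            (∀ᵐ μ ∂P, IsRootedHardCore δ μ) → IsPointStationaryLaw P →
            (∀ᵐ μ ∂P, ∃ S : Set (EuclideanSpace ℝ (Fin 3)),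
              μ = (Measure.count : Measure (EuclideanSpace ℝ (Fin 3))).restrict S ∧
              (∀ y ∈ S, SetGood S y) ∧
              ∃ s : ℤ → ℤ, IsHaggSeq s ∧
                ∃ Φ : EuclideanSpace ℝ (Fin 3) → EuclideanSpace ℝ (Fin 3),
                  Set.BijOn Φ (barlowStacking 1 (Real.sqrt (2 / 3)) s) S ∧
                  ∀ p ∈ barlowStacking 1 (Real.sqrt (2 / 3)) s, ∀ q ∈ barlowStacking 1 (Real.sqrt (2 / 3)) s,
                    (dist p q = 1 ↔ (0 < dist (Φ p) (Φ q) ∧ dist (Φ p) (Φ q) < 6 / 5))) →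
            (∀ᵐ μ ∂P, ∃ S : Set (EuclideanSpace ℝ (Fin 3)),
              μ = (Measure.count : Measure (EuclideanSpace ℝ (Fin 3))).restrict S ∧
              ∀ p ∈ S, HasSum (fun q : {q : EuclideanSpace ℝ (Fin 3) // q ∈ S ∧ q ≠ p} =>
                (deriv lennardJones (dist p q.1) / dist p q.1) • (p - q.1)) 0) →
            (∀ M : EuclideanSpace ℝ (Fin 3) →L[ℝ] EuclideanSpace ℝ (Fin 3),
              ∫ μ, (∫ y, deriv lennardJones ‖y‖ / ‖y‖ * inner ℝ y (M y) ∂μ) ∂P = 0) →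
            Summit.AtomisticToContinuum.Crystallization.Theorems.PalmUnimodularRigidity.LayeredLawsSelectHcp.hcpE a₀ h₀ +
                κ * (P {μ | ¬ ∃ a : ℝ, 9 / 10 ≤ a ∧ a ≤ 1 ∧ ∃ T : Finset (EuclideanSpace ℝ (Fin 3)),
                  (↑T : Set (EuclideanSpace ℝ (Fin 3))) =
                    {y : EuclideanSpace ℝ (Fin 3) | μ {y} ≠ 0 ∧ y ≠ 0 ∧ ‖y‖ ≤ 5 / 4 * a} ∧
                  (ShellCloseTo (a / 100) T (Finset.image (fun v : EuclideanSpace ℝ (Fin 3) => a • v) fccKissingPattern) ∨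
                    ShellCloseTo (a / 100) T
                      (Finset.image (fun v : EuclideanSpace ℝ (Fin 3) => a • v) hcpKissingPattern))}).toReal ≤
              ∫ μ, (∫ y, lennardJones ‖y‖ ∂μ) / 2 ∂P := by
  intro a₀ h₀ ha₁ ha₂ hh₁ hh₂ hmin δ hδ
  obtain ⟨κ, hκ, hcertδ⟩ := hcert a₀ h₀ ha₁ ha₂ hh₁ hh₂ hmin
  refine ⟨κ, hκ, fun P hP hcore hstat hchart hFB _hZS => ?_⟩
  -- name the conclusion predicate
  set G : Measure (EuclideanSpace ℝ (Fin 3)) → Prop := fun μ => ∃ a : ℝ, 9 / 10 ≤ a ∧ a ≤ 1 ∧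
      ∃ T : Finset (EuclideanSpace ℝ (Fin 3)),
        (↑T : Set (EuclideanSpace ℝ (Fin 3))) =
          {y : EuclideanSpace ℝ (Fin 3) | μ {y} ≠ 0 ∧ y ≠ 0 ∧ ‖y‖ ≤ 5 / 4 * a} ∧
        (ShellCloseTo (a / 100) T (Finset.image (fun v : EuclideanSpace ℝ (Fin 3) => a • v) fccKissingPattern) ∨
          ShellCloseTo (a / 100) T (Finset.image (fun v : EuclideanSpace ℝ (Fin 3) => a • v) hcpKissingPattern))
    with hG
  -- for every ε: hcpE − ε + κ·P*(bad) ≤ E_P[h]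
  have hb : ∀ ε : ℝ, 0 < ε →
      Summit.AtomisticToContinuum.Crystallization.Theorems.PalmUnimodularRigidity.LayeredLawsSelectHcp.hcpE a₀ h₀ - ε +
          κ * (P {μ | ¬ G μ}).toReal ≤ ∫ μ, (∫ y, lennardJones ‖y‖ ∂μ) / 2 ∂P := by
    intro ε hε
    obtain ⟨R, M, t, ht, hpt⟩ := hcertδ δ hδ ε hε
    have hae : ∀ᵐ μ ∂P,
        (Summit.AtomisticToContinuum.Crystallization.Theorems.PalmUnimodularRigidity.LayeredLawsSelectHcp.hcpE a₀ h₀ - ε ≤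
            (∫ y, lennardJones ‖y‖ ∂μ) / 2 + ∫ y, (t μ y - t (Measure.map (fun z => z - y) μ) (-y)) ∂μ) ∧
        (¬ G μ →
          Summit.AtomisticToContinuum.Crystallization.Theorems.PalmUnimodularRigidity.LayeredLawsSelectHcp.hcpE a₀ h₀ - ε + κ ≤
            (∫ y, lennardJones ‖y‖ ∂μ) / 2 + ∫ y, (t μ y - t (Measure.map (fun z => z - y) μ) (-y)) ∂μ) := by
      filter_upwards [hcore, hchart, hFB] with μ hc hch hfb
      exact hpt μ hc hch hfb
    exact AeMeckePricing.stub_aeMeckePricing δ hδ P hP hcore hstat R M t ht G _ κ hκ.le hae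
  -- let ε → 0
  refine le_of_forall_pos_lt_add fun ε hε => ?_
  have := hb (ε / 2) (by positivity)
  linarith

end Summit.AtomisticToContinuum.Crystallization.Theorems.PalmGoodLaw.RouteBetaPricedFloor

end
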